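import Literature.Algebra.EuclideanLattices.KhotOutputTable
import Literature.Algebra.EuclideanLattices.KhotBaseTable
import Literature.Algebra.EuclideanLattices.KhotParamsFP
import Literature.Computability.Complexity.AOWListMatrixFP
import HarnessLib

/-!
# Khot 2005, §5–7 on codes: the table programs of the reduction are polynomial-time

Topic `Algebra/EuclideanLattices`, namespace `Literature.Algebra.EuclideanLattices.Khot`. The functional
programs of `KhotOutputTable.lean` (`kronL`, `smulL`, `augPowTab`, `growthL`, `padRows`, `padTab`,
`hcatL`, `trL`, `outTab`) and `KhotBaseTable.lean` (`intEnt`, `baseEnt`, `baseTab`, `shiftL`) are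
computed on codes by polynomial-time string functions, in the typed algebra `CodeFP`
(`Computability/Complexity/CodeFP.lean`; list matrices coded by `LMat.matE`, dimensions in unary,
scalars as difference-pair integers `intE` / binary `natE`). Every statement is assembled from the
combinators of that algebra (`tabFP`, `sumRangeFP`, `entFP`, `map`, `ite`, numerals); no machine is
written and no growth estimate is needed beyond those the combinators discharge. No new facts.

## References

* S. Khot, *Hardness of approximating the shortest vector problem in lattices*, J. ACM 52 (2005)
  789–808, §7.3 ("a (randomized) reduction … that runs in time `n^{O(k²)}`").
* S. Arora, B. Barak, *Computational Complexity: A Modern Approach*, CUP 2009, §1.3.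
-/

namespace Literature.Algebra.EuclideanLattices.Khot

open Literature.Computability.Complexity Literature.Computability.Complexity.LMat
  Literature.Computability.Complexity.CodeFP

/-! ### Kronecker products, scaling, growth -/

section Tables

/-- **Kronecker products on codes**: `((1^{R₁}, 1^{C₁}, 1^{R₂}, 1^{C₂}), X, Y) ↦ kronL R₁ C₁ R₂ C₂ X Y`.
[cite: AroraBarak2009, §1.3] -/
theorem kronLFP : CodeFP (pairE (pairE unE (pairE unE (pairE unE unE))) (pairE matE matE)) matE
    (fun p => kronL p.1.1 p.1.2.1 p.1.2.2.1 p.1.2.2.2 p.2.1 p.2.2) := by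
  -- context `((R₂, C₂) binary, (X, Y))`, indices `(I, J)`
  let cE : (ℕ × ℕ) × (List (List ℤ) × List (List ℤ)) → List Bool := pairE (pairE natE natE) (pairE matE matE)
  let aE := pairE cE (pairE natE natE)
  have hI : CodeFP aE natE (fun t => t.2.1) := ((snd _ _).fst' :)
  have hJ : CodeFP aE natE (fun t => t.2.2) := ((snd _ _).snd' :)
  have hR : CodeFP aE natE (fun t => t.1.1.1) := ((fst _ _).fst'.fst' :)
  have hC : CodeFP aE natE (fun t => t.1.1.2) := ((fst _ _).fst'.snd' :)
  have hX : CodeFP aE matE (fun t => t.1.2.1) := ((fst _ _).snd'.fst' :)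
  have hY : CodeFP aE matE (fun t => t.1.2.2) := ((fst _ _).snd'.snd' :)
  have h1 : CodeFP aE intE (fun t => ent t.1.2.1 (t.2.1 / t.1.1.1) (t.2.2 / t.1.1.2)) := (entFP.comp (hX.pair ((natDiv.comp (hI.pair hR)).pair (natDiv.comp (hJ.pair hC)))) :)
  have h2 : CodeFP aE intE (fun t => ent t.1.2.2 (t.2.1 % t.1.1.1) (t.2.2 % t.1.1.2)) := (entFP.comp (hY.pair ((natMod.comp (hI.pair hR)).pair (natMod.comp (hJ.pair hC)))) :)
  have htab := (tabFP (intMul.comp (h1.pair h2)) :)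
  -- from the input: the context and the unary dimensions `R₁R₂`, `C₁C₂`
  let iE := pairE (pairE unE (pairE unE (pairE unE unE))) (pairE matE matE)
  have hR₁ : CodeFP iE unE (fun p => p.1.1) := ((fst _ _).fst' :)
  have hC₁ : CodeFP iE unE (fun p => p.1.2.1) := ((fst _ _).snd'.fst' :)
  have hR₂ : CodeFP iE unE (fun p => p.1.2.2.1) := ((fst _ _).snd'.snd'.fst' :)
  have hC₂ : CodeFP iE unE (fun p => p.1.2.2.2) := ((fst _ _).snd'.snd'.snd' :)
  have hctx : CodeFP iE cE (fun p => ((p.1.2.2.1, p.1.2.2.2), (p.2.1, p.2.2))) := (((natOfUn.comp hR₂).pair (natOfUn.comp hC₂)).pair ((snd _ _).fst'.pair (snd _ _).snd') :)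
  exact (htab.comp (hctx.pair ((unMul.comp (hR₁.pair hR₂)).pair (unMul.comp (hC₁.pair hC₂))))).congr fun p => rfl

/-- **Scaling on codes**: `((1ᴿ, 1ᶜ), W, X) ↦ smulL R C W X`. [cite: AroraBarak2009, §1.3] -/
theorem smulLFP : CodeFP (pairE (pairE unE unE) (pairE intE matE)) matE (fun p => smulL p.1.1 p.1.2 p.2.1 p.2.2) := by
  let cE : ℤ × List (List ℤ) → List Bool := pairE intE matE
  have hf : CodeFP (pairE cE (pairE natE natE)) intE (fun t => t.1.1 * ent t.1.2 t.2.1 t.2.2) := (intMul.comp ((fst _ _).fst'.pair (entFP.comp ((fst _ _).snd'.pair (snd _ _)))) :)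
  exact ((tabFP hf).comp ((snd _ _).pair (fst _ _))).congr fun p => rfl

/-- **Growth on codes**: `((1ᴿ, 1ᶜ), X) ↦ growthL R C X`. [cite: AroraBarak2009, §1.3] -/
theorem growthLFP : CodeFP (pairE (pairE unE unE) matE) intE (fun p => growthL p.1.1 p.1.2 p.2) := by
  -- inner sum: context `(X, i)`, variable `j`
  have hin : CodeFP (pairE (pairE matE natE) natE) intE (fun t => |ent t.1.1 t.1.2 t.2|) := (intAbs.comp (entFP.comp ((fst _ _).fst'.pair ((fst _ _).snd'.pair (snd _ _)))) :)
  have hsum := (sumRangeFP hin :)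
  -- outer sum: context `(X, 1ᶜ)`, variable `i`
  have hout : CodeFP (pairE (pairE matE unE) natE) intE (fun t => sumRange t.1.2 fun j => |ent t.1.1 t.2 j|) := (hsum.comp (((fst _ _).fst'.pair (snd _ _)).pair (fst _ _).snd') :)
  have h := (sumRangeFP hout :)
  exact (h.comp (((snd _ _).pair (fst _ _).snd').pair (fst _ _).fst')).congr fun p => rfl

/-- **The boosted basis on codes**: `((1ʳ, 1ᶜ), B0, W) ↦ augPowTab r c B0 W j`, level by level
(`j` is a constant of the reduction). [cite: Khot2005, §6.2 and §7.3] -/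
theorem augPowTabFP : ∀ j : ℕ,
    CodeFP (pairE (pairE unE unE) (pairE matE intE)) matE (fun p => augPowTab p.1.1 p.1.2 p.2.1 p.2.2 j)
  | 0 => (smulLFP.comp ((fst _ _).pair ((snd _ _).snd'.pair (snd _ _).fst'))).congr fun p => rfl
  | j + 1 => by
    let iE : (ℕ × ℕ) × (List (List ℤ) × ℤ) → List Bool := pairE (pairE unE unE) (pairE matE intE)
    have hr : CodeFP iE unE (fun p => p.1.1) := ((fst _ _).fst' :)
    have hc : CodeFP iE unE (fun p => p.1.2) := ((fst _ _).snd' :)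
    have hC : CodeFP iE unE (fun p => p.1.2 ^ (j + 1)) := ((unPowC (j + 1)).comp hc :)
    have hO : CodeFP iE unE (fun p => outCard p.1.1 p.1.2 j) := ((outCardFP j).comp (fst _ _) :)
    have hB : CodeFP iE matE (fun p => p.2.1) := ((snd _ _).fst' :)
    have h1 : CodeFP iE matE (fun p => kronL p.1.1 p.1.2 (p.1.2 ^ (j + 1)) (p.1.2 ^ (j + 1)) p.2.1 (oneL (p.1.2 ^ (j + 1)))) := (kronLFP.comp ((hr.pair (hc.pair (hC.pair hC))).pair (hB.pair (oneLFP.comp hC))) :)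
    have h2 : CodeFP iE matE (fun p => kronL p.1.1 p.1.2 (outCard p.1.1 p.1.2 j) (p.1.2 ^ (j + 1)) p.2.1
        (augPowTab p.1.1 p.1.2 p.2.1 p.2.2 j)) :=
      kronLFP.comp ((hr.pair (hc.pair (hO.pair hC))).pair (hB.pair (augPowTabFP j)))
    exact ((rawAppend (rawE intE)).comp (h1.pair h2)).congr fun p => rfl

/-- **The padded rows on codes**: `(1ʳ, 1ᶜ, 1ᵈ) ↦ padRows r c d j`. [cite: AroraBarak2009, §1.3] -/
theorem padRowsFP : ∀ j : ℕ, CodeFP (pairE unE (pairE unE unE)) (rawE natE) (fun p => padRows p.1 p.2.1 p.2.2 j)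
  | 0 => by
    have hm : CodeFP (pairE unitE natE) natE (fun t => t.2 + 1) := (natAdd.comp ((snd _ _).pair (const _ 1)) :)
    exact (((map hm).comp ((const _ ()).pair (urange.comp (snd _ _).snd'))).congr fun p => by
      simp [padRows])
  | j + 1 => by
    let iE : ℕ × (ℕ × ℕ) → List Bool := pairE unE (pairE unE unE)
    have hr : CodeFP iE unE (fun p => p.1) := (fst _ _ :)
    have hC : CodeFP iE unE (fun p => p.2.1 ^ (j + 1)) := ((unPowC (j + 1)).comp (snd _ _).fst' :)
    have hd : CodeFP iE unE (fun p => p.2.2) := ((snd _ _).snd' :)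
    have hO : CodeFP iE unE (fun p => outCard p.1 p.2.1 j) := ((outCardFP j).comp (hr.pair (snd _ _).fst') :)
    have hm : CodeFP (pairE natE natE) natE (fun t => t.2 + t.1) := (natAdd.comp ((snd _ _).pair (fst _ _)) :)
    have h1 : CodeFP iE (rawE natE) (fun p => (List.range (p.2.2 * p.2.1 ^ (j + 1))).map (· + p.2.1 ^ (j + 1))) := ((map hm).comp ((natOfUn.comp hC).pair (urange.comp (unMul.comp (hd.pair hC)))) :)
    have h2 : CodeFP iE (rawE natE)
        (fun p => (List.range (p.1 * outCard p.1 p.2.1 j)).map (· + p.1 * p.2.1 ^ (j + 1))) :=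
      (map hm).comp ((natOfUn.comp (unMul.comp (hr.pair hC))).pair (urange.comp (unMul.comp (hr.pair hO))))
    exact ((rawAppend natE).comp (h1.pair h2)).congr fun p => rfl

/-- **The padding block on codes**: `(1ᴿ, π, Kpad) ↦ padTab R π Kpad`. [cite: AroraBarak2009, §1.3] -/
theorem padTabFP : CodeFP (pairE unE (pairE (rawE natE) intE)) matE (fun p => padTab p.1 p.2.1 p.2.2) := by
  let cE : List ℕ × ℤ → List Bool := pairE (rawE natE) intE
  have hπ : CodeFP (pairE cE (pairE natE natE)) natE (fun t => t.1.1.getD t.2.2 0) := ((rawGetD natE (d := 0) rfl).comp ((fst _ _).fst'.pair (snd _ _).snd') :)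
  have hc : CodeFP (pairE cE (pairE natE natE)) bitE (fun t => decide (t.2.1 = t.1.1.getD t.2.2 0)) := (natEq.comp ((snd _ _).fst'.pair hπ) :)
  have hf : CodeFP (pairE cE (pairE natE natE)) intE (fun t => if t.2.1 = t.1.1.getD t.2.2 0 then t.1.2 else 0) := (iteP hc (fst _ _).snd' (const _ 0) :)
  exact ((tabFP hf).comp ((snd _ _).pair ((fst _ _).pair ((ulength natE).comp (snd _ _).fst')))).congr fun p => rfl

/-- **Horizontal concatenation on codes**: `((1ᴿ, 1^{C₁}, 1^{C₂}), X, Y) ↦ hcatL R C₁ C₂ X Y`.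
[cite: AroraBarak2009, §1.3] -/
theorem hcatLFP : CodeFP (pairE (pairE unE (pairE unE unE)) (pairE matE matE)) matE
    (fun p => hcatL p.1.1 p.1.2.1 p.1.2.2 p.2.1 p.2.2) := by
  -- context `(C₁ binary, (X, Y))`
  let cE : ℕ × (List (List ℤ) × List (List ℤ)) → List Bool := pairE natE (pairE matE matE)
  let aE := pairE cE (pairE natE natE)
  have hi : CodeFP aE natE (fun t => t.2.1) := ((snd _ _).fst' :)
  have hj : CodeFP aE natE (fun t => t.2.2) := ((snd _ _).snd' :)
  have hC : CodeFP aE natE (fun t => t.1.1) := ((fst _ _).fst' :)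
  have hc : CodeFP aE bitE (fun t => decide (t.2.2 < t.1.1)) := (natLt.comp (hj.pair hC) :)
  have hX : CodeFP aE intE (fun t => ent t.1.2.1 t.2.1 t.2.2) := (entFP.comp ((fst _ _).snd'.fst'.pair (hi.pair hj)) :)
  have hY : CodeFP aE intE (fun t => ent t.1.2.2 t.2.1 (t.2.2 - t.1.1)) := (entFP.comp ((fst _ _).snd'.snd'.pair (hi.pair (natSub.comp (hj.pair hC)))) :)
  have hf := (tabFP (iteP hc hX hY) :)
  exact (hf.comp ((((natOfUn.comp (fst _ _).snd'.fst').pair (snd _ _))).pair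
    ((fst _ _).fst'.pair (unAdd.comp ((fst _ _).snd'.fst'.pair (fst _ _).snd'.snd'))))).congr fun p => rfl

/-- **Transposition on codes**: `((1ᴿ, 1ᶜ), X) ↦ trL R C X`. [cite: AroraBarak2009, §1.3] -/
theorem trLFP : CodeFP (pairE (pairE unE unE) matE) matE (fun p => trL p.1.1 p.1.2 p.2) := by
  have hf : CodeFP (pairE matE (pairE natE natE)) intE (fun t => ent t.1 t.2.2 t.2.1) := (entFP.comp ((fst _ _).pair ((snd _ _).snd'.pair (snd _ _).fst')) :)
  exact ((tabFP hf).comp ((snd _ _).pair ((fst _ _).snd'.pair (fst _ _).fst'))).congr fun p => rfl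

/-- **The output table on codes**: `((1ʳ, 1ᶜ, 1ᵈ), B0, W, Kpad) ↦ outTab r c d B0 W Kpad k`.
[cite: Khot2005, §7.3] -/
theorem outTabFP (k : ℕ) : CodeFP (pairE (pairE unE (pairE unE unE)) (pairE matE (pairE intE intE))) matE
    (fun p => outTab p.1.1 p.1.2.1 p.1.2.2 p.2.1 p.2.2.1 p.2.2.2 k) := by
  let iE : (ℕ × (ℕ × ℕ)) × (List (List ℤ) × (ℤ × ℤ)) → List Bool :=
    pairE (pairE unE (pairE unE unE)) (pairE matE (pairE intE intE))
  have hr : CodeFP iE unE (fun p => p.1.1) := ((fst _ _).fst' :)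
  have hc : CodeFP iE unE (fun p => p.1.2.1) := ((fst _ _).snd'.fst' :)
  have hd : CodeFP iE unE (fun p => p.1.2.2) := ((fst _ _).snd'.snd' :)
  have hN : CodeFP iE unE (fun p => outCard p.1.1 p.1.2.1 k) := ((outCardFP k).comp (hr.pair hc) :)
  have hC : CodeFP iE unE (fun p => p.1.2.1 ^ (k + 1)) := ((unPowC (k + 1)).comp hc :)
  have hP : CodeFP iE unE (fun p => padCard p.1.1 p.1.2.1 p.1.2.2 k) := ((padCardFP k).comp (fst _ _) :)
  have hA : CodeFP iE matE (fun p => augPowTab p.1.1 p.1.2.1 p.2.1 p.2.2.1 k) := ((augPowTabFP k).comp ((hr.pair hc).pair ((snd _ _).fst'.pair (snd _ _).snd'.fst')) :)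
  have hπ : CodeFP iE (rawE natE) (fun p => padRows p.1.1 p.1.2.1 p.1.2.2 k) := ((padRowsFP k).comp (fst _ _) :)
  have hpad : CodeFP iE matE (fun p => padTab (outCard p.1.1 p.1.2.1 k) (padRows p.1.1 p.1.2.1 p.1.2.2 k) p.2.2.2) := (padTabFP.comp (hN.pair (hπ.pair (snd _ _).snd'.snd')) :)
  have hh : CodeFP iE matE (fun p => hcatL (outCard p.1.1 p.1.2.1 k) (p.1.2.1 ^ (k + 1)) (padCard p.1.1 p.1.2.1 p.1.2.2 k)
      (augPowTab p.1.1 p.1.2.1 p.2.1 p.2.2.1 k) (padTab (outCard p.1.1 p.1.2.1 k) (padRows p.1.1 p.1.2.1 p.1.2.2 k) p.2.2.2)) :=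
    hcatLFP.comp ((hN.pair (hC.pair hP)).pair (hA.pair hpad))
  exact ((trLFP.comp ((hN.pair hN).pair hh))).congr fun p => rfl

end Tables

/-! ### The base basis and the sampled shift on codes -/

section Base

/-- The code of the data of the intermediate basis: `((u, σ, h, N), ((sets, Ptab, sL), Q))`. [folklore] -/
abbrev intCtxE : (ℕ × (ℕ × (ℕ × ℕ))) × ((List (List ℕ) × (List (List ℤ) × List ℤ)) × ℤ) → List Bool :=
  pairE (pairE natE (pairE natE (pairE natE natE))) (pairE (pairE (rawE (rawE natE)) (pairE matE (rawE intE))) intE)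

/-- **The entries of the intermediate basis on codes**: `(ctx, (i, j)) ↦ intEnt u σ h N sets Ptab sL Q i j`.
[cite: Khot2005, §5.1 (Fig. 3); AroraBarak2009, §1.3] -/
theorem intEntFP : CodeFP (pairE intCtxE (pairE natE natE)) intE
    (fun t => intEnt t.1.1.1 t.1.1.2.1 t.1.1.2.2.1 t.1.1.2.2.2 t.1.2.1.1 t.1.2.1.2.1 t.1.2.1.2.2 t.1.2.2 t.2.1 t.2.2) := by
  let aE := pairE intCtxE (pairE natE natE)
  have hi : CodeFP aE natE (fun t => t.2.1) := ((snd _ _).fst' :)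
  have hj : CodeFP aE natE (fun t => t.2.2) := ((snd _ _).snd' :)
  have hu : CodeFP aE natE (fun t => t.1.1.1) := ((fst _ _).fst'.fst' :)
  have hσ : CodeFP aE natE (fun t => t.1.1.2.1) := ((fst _ _).fst'.snd'.fst' :)
  have hh : CodeFP aE natE (fun t => t.1.1.2.2.1) := ((fst _ _).fst'.snd'.snd'.fst' :)
  have hN : CodeFP aE natE (fun t => t.1.1.2.2.2) := ((fst _ _).fst'.snd'.snd'.snd' :)
  have hsets : CodeFP aE (rawE (rawE natE)) (fun t => t.1.2.1.1) := ((fst _ _).snd'.fst'.fst' :)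
  have hP : CodeFP aE matE (fun t => t.1.2.1.2.1) := ((fst _ _).snd'.fst'.snd'.fst' :)
  have hsL : CodeFP aE (rawE intE) (fun t => t.1.2.1.2.2) := ((fst _ _).snd'.fst'.snd'.snd' :)
  have hQ : CodeFP aE intE (fun t => t.1.2.2) := ((fst _ _).snd'.snd' :)
  have huσ : CodeFP aE natE (fun t => t.1.1.1 + t.1.1.2.1) := (natAdd.comp (hu.pair hσ) :)
  have huσh : CodeFP aE natE (fun t => t.1.1.1 + t.1.1.2.1 + t.1.1.2.2.1) := (natAdd.comp (huσ.pair hh) :)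
  have hσN : CodeFP aE natE (fun t => t.1.1.2.1 + t.1.1.2.2.2) := (natAdd.comp (hσ.pair hN) :)
  have hσNh : CodeFP aE natE (fun t => t.1.1.2.1 + t.1.1.2.2.2 + t.1.1.2.2.1) := (natAdd.comp (hσN.pair hh) :)
  have h2Q : CodeFP aE intE (fun t => 2 * t.1.2.2) := (intMul.comp ((const _ (2 : ℤ)).pair hQ) :)
  have h0 : CodeFP aE intE (fun _ => (0 : ℤ)) := const _ 0
  -- universe rows
  have hmem : CodeFP aE bitE (fun t => decide (t.2.1 ∈ t.1.2.1.1.getD t.2.2 [])) :=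
    ((mem natE_injective).comp (hi.pair ((rawGetD (rawE natE) (d := ([] : List ℕ)) rfl).comp (hsets.pair hj))) :)
  have hA : CodeFP aE intE (fun t =>
      if t.2.2 < t.1.1.2.1 then (if t.2.1 ∈ t.1.2.1.1.getD t.2.2 [] then 2 * t.1.2.2 else 0)
      else if t.2.2 = t.1.1.2.1 + t.1.1.2.2.2 + t.1.1.2.2.1 then 2 * t.1.2.2 else 0) :=
    (iteP (natLt.comp (hj.pair hσ)) (iteP hmem h2Q h0) (iteP (natEq.comp (hj.pair hσNh)) h2Q h0) :)
  -- set rows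
  have hB : CodeFP aE intE (fun t =>
      if t.2.2 < t.1.1.2.1 then (if t.2.1 - t.1.1.1 = t.2.2 then (2 : ℤ) else 0) else 0) :=
    (iteP (natLt.comp (hj.pair hσ)) (iteP (natEq.comp ((natSub.comp (hi.pair hu)).pair hj)) (const _ 2) h0) h0 :)
  -- BCH rows
  have hC : CodeFP aE intE (fun t =>
      if t.2.2 < t.1.1.2.1 then 0
      else if t.2.2 < t.1.1.2.1 + t.1.1.2.2.2 then t.1.2.2 * ent t.1.2.1.2.1 (t.2.1 - (t.1.1.1 + t.1.1.2.1)) (t.2.2 - t.1.1.2.1)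
      else if t.2.2 < t.1.1.2.1 + t.1.1.2.2.2 + t.1.1.2.2.1 then
        (if t.2.1 - (t.1.1.1 + t.1.1.2.1) = t.2.2 - (t.1.1.2.1 + t.1.1.2.2.2) then 2 * t.1.2.2 else 0)
      else if t.2.2 = t.1.1.2.1 + t.1.1.2.2.2 + t.1.1.2.2.1 then t.1.2.2 * t.1.2.1.2.2.getD (t.2.1 - (t.1.1.1 + t.1.1.2.1)) 0
      else 0) :=
    (iteP (natLt.comp (hj.pair hσ)) h0
      (iteP (natLt.comp (hj.pair hσN))
        (intMul.comp (hQ.pair (entFP.comp (hP.pair ((natSub.comp (hi.pair huσ)).pair (natSub.comp (hj.pair hσ)))))))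
        (iteP (natLt.comp (hj.pair hσNh))
          (iteP (natEq.comp ((natSub.comp (hi.pair huσ)).pair (natSub.comp (hj.pair hσN)))) h2Q h0)
          (iteP (natEq.comp (hj.pair hσNh))
            (intMul.comp (hQ.pair ((rawGetOr intE).comp (hsL.pair ((natSub.comp (hi.pair huσ)).pair h0)))))
            h0))) :)
  -- column rows
  have hand' := ((natLe.comp (hσ.pair hj)).and (natLt.comp (hj.pair hσN)) :)
  have hand : CodeFP aE bitE (fun t => decide (t.1.1.2.1 ≤ t.2.2 ∧ t.2.2 < t.1.1.2.1 + t.1.1.2.2.2)) :=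
    hand'.congr fun t => by simp [Bool.decide_and]
  have hE : CodeFP aE intE (fun t =>
      if t.1.1.2.1 ≤ t.2.2 ∧ t.2.2 < t.1.1.2.1 + t.1.1.2.2.2 then
        (if t.2.1 - (t.1.1.1 + t.1.1.2.1 + t.1.1.2.2.1) = t.2.2 - t.1.1.2.1 then (1 : ℤ) else 0) else 0) :=
    (iteP hand (iteP (natEq.comp ((natSub.comp (hi.pair huσh)).pair (natSub.comp (hj.pair hσ)))) (const _ 1) h0) h0 :)
  have hfin := (iteP (natLt.comp (hi.pair hu)) hA (iteP (natLt.comp (hi.pair huσ)) hB (iteP (natLt.comp (hi.pair huσh)) hC hE)) :)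
  exact hfin.congr fun t => rfl

/-- The code of the data of the base basis: `((1^ρ, intCtx), (D, q, rL))`, `ρ = u+σ+h+N`. [folklore] -/
abbrev baseCtxE : (ℕ × ((ℕ × (ℕ × (ℕ × ℕ))) × ((List (List ℕ) × (List (List ℤ) × List ℤ)) × ℤ))) × (ℤ × (ℤ × List ℤ)) →
    List Bool :=
  pairE (pairE unE intCtxE) (pairE intE (pairE intE (rawE intE)))

/-- **The entries of the base basis on codes**: `(ctx, (i, j)) ↦ baseEnt … i j` (the context carries
`ρ = u+σ+h+N` in unary, for the sum of the last row). [cite: Khot2005, §5.2.2 (Fig. 4); AroraBarak2009, §1.3] -/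
theorem baseEntFP : CodeFP (pairE baseCtxE (pairE natE natE)) intE
    (fun t => baseEnt t.1.1.1 t.1.1.2.1.1 t.1.1.2.1.2.1 t.1.1.2.1.2.2.1 t.1.1.2.1.2.2.2 t.1.1.2.2.1.1 t.1.1.2.2.1.2.1
      t.1.1.2.2.1.2.2 t.1.1.2.2.2 t.1.2.1 t.1.2.2.1 t.1.2.2.2 t.2.1 t.2.2) := by
  let aE := pairE baseCtxE (pairE natE natE)
  have hi : CodeFP aE natE (fun t => t.2.1) := ((snd _ _).fst' :)
  have hj : CodeFP aE natE (fun t => t.2.2) := ((snd _ _).snd' :)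
  have hctx : CodeFP aE intCtxE (fun t => t.1.1.2) := ((fst _ _).fst'.snd' :)
  have hρ : CodeFP aE unE (fun t => t.1.1.1) := ((fst _ _).fst'.fst' :)
  have hu : CodeFP aE natE (fun t => t.1.1.2.1.1) := (hctx.fst'.fst' :)
  have hσ : CodeFP aE natE (fun t => t.1.1.2.1.2.1) := (hctx.fst'.snd'.fst' :)
  have hh : CodeFP aE natE (fun t => t.1.1.2.1.2.2.1) := (hctx.fst'.snd'.snd'.fst' :)
  have hN : CodeFP aE natE (fun t => t.1.1.2.1.2.2.2) := (hctx.fst'.snd'.snd'.snd' :)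
  have hD : CodeFP aE intE (fun t => t.1.2.1) := ((fst _ _).snd'.fst' :)
  have hq : CodeFP aE intE (fun t => t.1.2.2.1) := ((fst _ _).snd'.snd'.fst' :)
  have hrL : CodeFP aE (rawE intE) (fun t => t.1.2.2.2) := ((fst _ _).snd'.snd'.snd' :)
  have hρb : CodeFP aE natE (fun t => t.1.1.2.1.1 + t.1.1.2.1.2.1 + t.1.1.2.1.2.2.1 + t.1.1.2.1.2.2.2) :=
    (natAdd.comp ((natAdd.comp ((natAdd.comp (hu.pair hσ)).pair hh)).pair hN) :)
  have hcb : CodeFP aE natE (fun t => t.1.1.2.1.2.1 + t.1.1.2.1.2.2.2 + t.1.1.2.1.2.2.1 + 1) :=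
    (natAdd.comp ((natAdd.comp ((natAdd.comp (hσ.pair hN)).pair hh)).pair (const _ 1)) :)
  have hint : CodeFP aE intE (fun t => intEnt t.1.1.2.1.1 t.1.1.2.1.2.1 t.1.1.2.1.2.2.1 t.1.1.2.1.2.2.2 t.1.1.2.2.1.1
      t.1.1.2.2.1.2.1 t.1.1.2.2.1.2.2 t.1.1.2.2.2 t.2.1 t.2.2) := (intEntFP.comp (hctx.pair (hi.pair hj)) :)
  -- the last row: context `(t, j)`… as `((ctx, rL), j)` with variable `i'`
  let sE := pairE (pairE intCtxE (rawE intE)) natE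
  have hsummand : CodeFP (pairE sE natE) intE (fun w => w.1.1.2.getD w.2 0 *
      intEnt w.1.1.1.1.1 w.1.1.1.1.2.1 w.1.1.1.1.2.2.1 w.1.1.1.1.2.2.2 w.1.1.1.2.1.1 w.1.1.1.2.1.2.1 w.1.1.1.2.1.2.2
        w.1.1.1.2.2 w.2 w.1.2) :=
    (intMul.comp (((rawGetOr intE).comp ((fst _ _).fst'.snd'.pair ((snd _ _).pair (const _ (0 : ℤ))))).pair
      (intEntFP.comp ((fst _ _).fst'.fst'.pair ((snd _ _).pair (fst _ _).snd')))) :)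
  have hsum := (sumRangeFP hsummand :)
  have hlast : CodeFP aE intE (fun t => sumRange (t.1.1.1) fun i' => t.1.2.2.2.getD i' 0 *
      intEnt t.1.1.2.1.1 t.1.1.2.1.2.1 t.1.1.2.1.2.2.1 t.1.1.2.1.2.2.2 t.1.1.2.2.1.1 t.1.1.2.2.1.2.1 t.1.1.2.2.1.2.2
        t.1.1.2.2.2 i' t.2.2) := (hsum.comp (((hctx.pair hrL).pair hj).pair hρ) :)
  have hfin := (iteP (natLt.comp (hi.pair hρb)) (iteP (natLt.comp (hj.pair hcb)) hint (const _ 0))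
    (iteP (natLt.comp (hj.pair hcb)) (intMul.comp (hD.pair hlast)) (intMul.comp (hD.pair hq))) :)
  exact hfin.congr fun t => rfl

/-- **The base basis on codes**: `(ctx, dims) ↦ baseTab …`, the dimensions `(1^{ρ+1}, 1^{cσ})` supplied
in unary next to the context. [cite: Khot2005, §5.2.2 (Fig. 4); AroraBarak2009, §1.3] -/
theorem baseTabFP : CodeFP (pairE baseCtxE (pairE unE unE)) matE
    (fun t => tab t.2.1 t.2.2 (baseEnt t.1.1.1 t.1.1.2.1.1 t.1.1.2.1.2.1 t.1.1.2.1.2.2.1 t.1.1.2.1.2.2.2 t.1.1.2.2.1.1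
      t.1.1.2.2.1.2.1 t.1.1.2.2.1.2.2 t.1.1.2.2.2 t.1.2.1 t.1.2.2.1 t.1.2.2.2)) :=
  (tabFP baseEntFP).congr fun _ => rfl

/-- **The sampled shift on codes**: `((1ʰ, 1ᴺ), Ptab, gL) ↦ shiftL h N Ptab gL`.
[cite: Khot2005, Lemma 4.3 (proof); AroraBarak2009, §1.3] -/
theorem shiftLFP : CodeFP (pairE (pairE unE unE) (pairE matE (rawE natE))) (rawE intE)
    (fun p => shiftL p.1.1 p.1.2 p.2.1 p.2.2) := by
  -- summand: context `((Ptab, gL), hr)`, variable `nc`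
  let sE := pairE (pairE matE (rawE natE)) natE
  have hmemb : CodeFP (pairE sE natE) bitE (fun w => decide (w.2 ∈ w.1.1.2)) :=
    ((mem natE_injective).comp ((snd _ _).pair (fst _ _).fst'.snd') :)
  have hsummand : CodeFP (pairE sE natE) intE (fun w => if w.2 ∈ w.1.1.2 then ent w.1.1.1 w.1.2 w.2 else 0) :=
    (iteP hmemb (entFP.comp ((fst _ _).fst'.fst'.pair ((fst _ _).snd'.pair (snd _ _)))) (const _ 0) :)
  have hsum := (sumRangeFP hsummand :)
  -- the row map: context `((Ptab, gL), 1ᴺ)`, item `hr`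
  let rE := pairE (pairE matE (rawE natE)) unE
  have hrow : CodeFP (pairE rE natE) intE
      (fun w => (sumRange w.1.2 fun nc => if nc ∈ w.1.1.2 then ent w.1.1.1 w.2 nc else 0) % 2) :=
    (intEMod.comp ((hsum.comp (((fst _ _).fst'.pair (snd _ _)).pair (fst _ _).snd')).pair (const _ (2 : ℤ))) :)
  have hmap := (map hrow :)
  exact (hmap.comp (((snd _ _).pair (fst _ _).snd').pair (urange.comp (fst _ _).fst'))).congr fun p => rfl

end Base

end Literature.Algebra.EuclideanLattices.Khot
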